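import Mathlib
import HarnessLib
import Summits.Ventures.LatticeQCDFlow.Scoring.DoeblinAutocorrelation
import Summits.Ventures.LatticeQCDFlow.Exactness.AdjointKernels
import Summits.Ventures.LatticeQCDFlow.Exactness.ReversibleTauIntFloor

/-!
# Every reversible Markov kernel: symmetric transition operator on observables, pair-positive
# autocovariances, odd windows below `τ_int`, and the floor `τ_int ≥ (1 + ρ₁)/(2(1 − ρ₁))`

HONEST FRAMING: exact (Metropolis-corrected) sampling algorithms for lattice gauge theory;
figures of merit are autocorrelation/cost numbers at stated couplings and volumes; no
continuum-physics claim.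

Venture `LatticeQCDFlow` (cell pub-lqcd), topic `Scoring`; FANOUT row 8 (`s0-cpn-nemc`, GEN-11).
NEW WORK of the cell (bookkeeping, three short arguments), not a published result.  It joins three
tree files: row 8's kernel-level vocabulary `Scoring/KernelTransitionOperator.lean` (`kop κ g x =
∫ g d(κ x)`, `autocov κ π f t = ∫ f · (kop κ)^[t] f dπ`) and `Scoring/DoeblinAutocorrelation.lean`
(`integral_sq_iterate_kop_le`: `L²(π)`-contraction from invariance), row 9's
`Exactness/AdjointKernels.lean` (`IsAdjointPair.compProd_swap`: Mathlib's set-wise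
`Kernel.IsReversible` is the identity of measures `(π ⊗ κ).map swap = π ⊗ κ`), and row 2's ABSTRACT
operator theorems of `Exactness/ReversibleTauIntFloor.lean` (`op_pair_nonneg`, `op_tsum_nonneg`,
`reversible_tauInt_ge`, stated for any linear, bounded-measurable-preserving, `L²(w dμ)`-symmetric
contraction `K`).  Printed counterpart, NAMED ONLY: Madras–Slade 1993, *The Self-Avoiding Walk*,
Prop. 9.2.2 (finite reversible chains, spectral theorem).

## What is proved (`κ` a Markov kernel on any measurable space `Ω`)

* §1 `kop_add_mul` (linearity on bounded measurable observables) and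
  **`integral_kop_mul_comm_of_isReversible`**: for a finite measure `π` with `Kernel.IsReversible κ π`
  and bounded measurable `f, g`: `∫ (kop κ f) · g dπ = ∫ f · (kop κ g) dπ` — REVERSIBILITY ON
  OBSERVABLES (detailed balance in its functional form, by Fubini for `π ⊗ₘ κ`).
* §2 (`π` an invariant probability law, `κ` `π`-reversible; `g`, `h` bounded measurable; `C_g(t) =
  autocov κ π g t`, `ρ(t) = C_g(t)/C_g(0)`): the four hypotheses of row 2's abstract theorems hold for
  `(μ, w, K) = (π, 1, kop κ)` (`kop_opBdd`, `kop_opLin`, `kop_opSymm`, `kop_opContr`), hence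
  **`autocov_even_nonneg_of_isReversible`** (`C_g(2m) = ‖(kop κ)^[m] g‖² ≥ 0`),
  **`autocov_pair_nonneg_of_isReversible`** (`0 ≤ C_h(2m) + C_h(2m+1)`),
  **`tsum_autocov_nonneg_of_isReversible`** (`0 ≤ Σ_{t ≥ 0} C_h(t)` whenever summable — the
  resolvent form `⟨h, (1 − K)⁻¹ h⟩_π ≥ 0` without operator theory),
  **`tauIntWindow_odd_mono_of_isReversible`** / **`tauIntWindow_odd_le_tauInt_of_isReversible`**
  (windows ending at an ODD lag, `τ_{2N+1} = 1/2 + Σ_{t ≤ 2N+1} ρ(t)`, are nondecreasing in `N` and,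
  for a summable autocorrelation, never exceed `τ_int`: for every reversible sampler an odd-ended
  Γ-window is a certified LOWER bound), and
  **`tauInt_ge_of_isReversible`**: if `Σ ρ` is summable and `ρ(1) < 1` then
  `(1 + ρ(1))/(2(1 − ρ(1))) ≤ τ_int(g)` — Madras–Slade's floor for EVERY `π`-reversible Markov kernel
  on a general state space (HMC, heat bath, Metropolis, the flow sampler), as a theorem about the
  tree's `Scoring.tauInt`.

Reading (markdown): a measured lag-one autocorrelation of any bounded observable under any exact
REVERSIBLE update certifies `ESS/N ≤ (1 − ρ(1))/(1 + ρ(1))`; the positive-operator case (all lags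
`≥ 0`, all windows monotone) is the flow sampler's, `Scoring/FlowSamplerAutocorrelationFloor.lean`.
NOT CLAIMED: summability or `ρ(1) < 1` for any particular kernel (hypotheses; both follow from a
Doeblin or spectral gap), non-reversible sweeps, unbounded observables, any number of ours.
-/

noncomputable section

namespace Summit.Ventures.LatticeQCDFlow.Scoring

open MeasureTheory ProbabilityTheory Filter Finset Summit.Ventures.LatticeQCDFlow.Exactness
open scoped ENNReal Topology

variable {Ω : Type*} [MeasurableSpace Ω]

/-! ### §1 Linearity and reversibility on observables -/

section Observables

variable (κ : Kernel Ω Ω) [IsMarkovKernel κ]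

/-- `kop` is linear on bounded measurable observables: `K(f + c·h) = K f + c·K h`. -/
theorem kop_add_mul {f h : Ω → ℝ} (hf : Measurable f) (hh : Measurable h) {Bf Bh : ℝ}
    (hBf : ∀ x, |f x| ≤ Bf) (hBh : ∀ x, |h x| ≤ Bh) (c : ℝ) (x : Ω) :
    kop κ (fun s => f s + c * h s) x = kop κ f x + c * kop κ h x := by
  unfold kop
  rw [integral_add (integrable_of_bounded (κ x) hf hBf)
      ((integrable_of_bounded (κ x) hh hBh).const_mul c), integral_const_mul]

/-- **Reversibility on observables.**  If the Markov kernel `κ` is `π`-reversible (Mathlib's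
`Kernel.IsReversible`: detailed balance on measurable rectangles) for a finite measure `π`, then its
transition operator is SYMMETRIC on bounded measurable observables:
`∫ (kop κ f) · g dπ = ∫ f · (kop κ g) dπ`.  (Row 9's `IsAdjointPair.compProd_swap` turns detailed
balance into `(π ⊗ₘ κ).map swap = π ⊗ₘ κ`; Fubini for the composition-product does the rest.) -/
theorem integral_kop_mul_comm_of_isReversible {π : Measure Ω} [IsFiniteMeasure π]
    (hrev : Kernel.IsReversible κ π) {f g : Ω → ℝ} (hf : Measurable f) (hg : Measurable g)
    {Bf Bg : ℝ} (hBf : ∀ x, |f x| ≤ Bf) (hBg : ∀ x, |g x| ≤ Bg) :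
    ∫ x, kop κ f x * g x ∂π = ∫ x, f x * kop κ g x ∂π := by
  have hswap : (π ⊗ₘ κ).map Prod.swap = π ⊗ₘ κ := hrev.isAdjointPair.compProd_swap
  have hFm : Measurable fun p : Ω × Ω => g p.1 * f p.2 :=
    (hg.comp measurable_fst).mul (hf.comp measurable_snd)
  have hFb : ∀ p : Ω × Ω, |g p.1 * f p.2| ≤ Bg * Bf := fun p => by
    rw [abs_mul]
    exact mul_le_mul (hBg _) (hBf _) (abs_nonneg _) ((abs_nonneg _).trans (hBg p.1))
  have hGm : Measurable fun p : Ω × Ω => g p.2 * f p.1 :=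
    (hg.comp measurable_snd).mul (hf.comp measurable_fst)
  have hGb : ∀ p : Ω × Ω, |g p.2 * f p.1| ≤ Bg * Bf := fun p => by
    rw [abs_mul]
    exact mul_le_mul (hBg _) (hBf _) (abs_nonneg _) ((abs_nonneg _).trans (hBg p.2))
  have hFi : Integrable (fun p : Ω × Ω => g p.1 * f p.2) (π ⊗ₘ κ) :=
    integrable_of_bounded _ hFm hFb
  have hGi : Integrable (fun p : Ω × Ω => g p.2 * f p.1) (π ⊗ₘ κ) :=
    integrable_of_bounded _ hGm hGb
  calc ∫ x, kop κ f x * g x ∂π = ∫ x, ∫ y, g x * f y ∂(κ x) ∂π := by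
        refine integral_congr_ae (ae_of_all _ fun x => ?_)
        show kop κ f x * g x = ∫ y, g x * f y ∂(κ x)
        rw [integral_const_mul, mul_comm]
        rfl
    _ = ∫ p, g p.1 * f p.2 ∂(π ⊗ₘ κ) := (Measure.integral_compProd hFi).symm
    _ = ∫ p, g p.1 * f p.2 ∂((π ⊗ₘ κ).map Prod.swap) := by rw [hswap]
    _ = ∫ p, g p.2 * f p.1 ∂(π ⊗ₘ κ) :=
        integral_map measurable_swap.aemeasurable hFm.aestronglyMeasurable
    _ = ∫ x, ∫ y, g y * f x ∂(κ x) ∂π := Measure.integral_compProd hGi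
    _ = ∫ x, f x * kop κ g x ∂π := by
        refine integral_congr_ae (ae_of_all _ fun x => ?_)
        show ∫ y, g y * f x ∂(κ x) = f x * kop κ g x
        rw [integral_mul_const, mul_comm]
        rfl

end Observables

/-! ### §2 Pair positivity, odd windows and the `τ_int` floor for every reversible kernel -/

section Floor

variable {κ : Kernel Ω Ω} [IsMarkovKernel κ] {π : Measure Ω} [IsProbabilityMeasure π]

/-- (bdd) `kop κ` maps "measurable with `|·| ≤ B`" to itself. -/
theorem kop_opBdd : ∀ ⦃f : Ω → ℝ⦄ ⦃B : ℝ⦄, Measurable f → (∀ x, |f x| ≤ B) →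
    Measurable (kop κ f) ∧ ∀ x, |kop κ f x| ≤ B :=
  fun _ _ hf hB => ⟨measurable_kop κ hf, abs_kop_le κ hB⟩

/-- (lin) `kop κ` is linear, in the shape of row 2's abstract hypotheses. -/
theorem kop_opLin : ∀ ⦃f h : Ω → ℝ⦄ ⦃Bf Bh : ℝ⦄ (c : ℝ), Measurable f → Measurable h →
    (∀ x, |f x| ≤ Bf) → (∀ x, |h x| ≤ Bh) →
    ∀ x, kop κ (fun s => f s + c * h s) x = kop κ f x + c * kop κ h x :=
  fun _ _ _ _ c hf hh hBf hBh x => kop_add_mul κ hf hh hBf hBh c x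

/-- (symm) a `π`-reversible kernel is symmetric on `L²(π)` (weight `w = 1`). -/
theorem kop_opSymm (hrev : Kernel.IsReversible κ π) :
    ∀ ⦃f h : Ω → ℝ⦄ ⦃Bf Bh : ℝ⦄, Measurable f → Measurable h → (∀ x, |f x| ≤ Bf) →
      (∀ x, |h x| ≤ Bh) →
      ∫ x, kop κ f x * h x * (fun _ : Ω => (1 : ℝ)) x ∂π
        = ∫ x, f x * kop κ h x * (fun _ : Ω => (1 : ℝ)) x ∂π := by
  intro f h Bf Bh hf hh hBf hBh
  simp only [mul_one]
  exact integral_kop_mul_comm_of_isReversible κ hrev hf hh hBf hBh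

/-- (contr) an invariant kernel is an `L²(π)`-contraction (weight `w = 1`). -/
theorem kop_opContr (hinv : Kernel.Invariant κ π) :
    ∀ ⦃f : Ω → ℝ⦄ ⦃B : ℝ⦄, Measurable f → (∀ x, |f x| ≤ B) →
      ∫ x, kop κ f x ^ 2 * (fun _ : Ω => (1 : ℝ)) x ∂π
        ≤ ∫ x, f x ^ 2 * (fun _ : Ω => (1 : ℝ)) x ∂π := by
  intro f B hf hB
  simp only [mul_one]
  have h := integral_sq_iterate_kop_le κ hinv hf hB 1
  simpa only [Function.iterate_one] using h

omit [IsMarkovKernel κ] [IsProbabilityMeasure π] in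
/-- The weight-`1` forms are the tree's `autocov`. -/
theorem integral_mul_iterate_kop_mul_one (g : Ω → ℝ) (n : ℕ) :
    ∫ x, g x * (kop κ)^[n] g x * (fun _ : Ω => (1 : ℝ)) x ∂π = autocov κ π g n := by
  simp only [mul_one]
  rfl

/-- **Even lags are squares**: `C_g(2m) = ∫ ((kop κ)^[m] g)² dπ ≥ 0` for a `π`-reversible kernel. -/
theorem autocov_even_nonneg_of_isReversible (hrev : Kernel.IsReversible κ π) {g : Ω → ℝ}
    (hg : Measurable g) {B : ℝ} (hB : ∀ x, |g x| ≤ B) (m : ℕ) :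
    0 ≤ autocov κ π g (2 * m) := by
  have two := op_two_time (μ := π) (w := fun _ : Ω => (1 : ℝ)) (K := kop κ) kop_opBdd
    (kop_opSymm hrev) hg hB m m
  rw [← two_mul, integral_mul_iterate_kop_mul_one] at two
  rw [← two]
  exact integral_nonneg fun x => by simp only [mul_one]; exact mul_self_nonneg _

/-- **PAIR POSITIVITY for every reversible kernel**: `0 ≤ C_h(2m) + C_h(2m+1)` for every bounded
measurable `h` (`= ‖Kᵐh‖² + ⟨Kᵐh, K Kᵐh⟩ ≥ 0` by Cauchy–Schwarz and contraction). -/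
theorem autocov_pair_nonneg_of_isReversible (hrev : Kernel.IsReversible κ π) {h : Ω → ℝ}
    (hh : Measurable h) {B : ℝ} (hB : ∀ x, |h x| ≤ B) (m : ℕ) :
    0 ≤ autocov κ π h (2 * m) + autocov κ π h (2 * m + 1) := by
  have key := op_pair_nonneg (μ := π) (w := fun _ : Ω => (1 : ℝ)) (K := kop κ)
    (fun _ => one_pos) measurable_const (integrable_const _) kop_opBdd (kop_opSymm hrev)
    (kop_opContr hrev.invariant) hh hB m
  rwa [integral_mul_iterate_kop_mul_one, integral_mul_iterate_kop_mul_one] at key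

/-- **Resolvent positivity for every reversible kernel**: if `t ↦ C_h(t)` is summable then
`0 ≤ Σ_{t ≥ 0} C_h(t)` (`= ⟨h, (1 − K)⁻¹ h⟩_π`). -/
theorem tsum_autocov_nonneg_of_isReversible (hrev : Kernel.IsReversible κ π) {h : Ω → ℝ}
    (hh : Measurable h) {B : ℝ} (hB : ∀ x, |h x| ≤ B) (hs : Summable (autocov κ π h)) :
    0 ≤ ∑' t, autocov κ π h t := by
  have e : (fun n => ∫ x, h x * (kop κ)^[n] h x * (fun _ : Ω => (1 : ℝ)) x ∂π)
      = autocov κ π h := funext fun n => integral_mul_iterate_kop_mul_one h n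
  have key := op_tsum_nonneg (μ := π) (w := fun _ : Ω => (1 : ℝ)) (K := kop κ)
    (fun _ => one_pos) measurable_const (integrable_const _) kop_opBdd (kop_opSymm hrev)
    (kop_opContr hrev.invariant) hh hB (by rw [e]; exact hs)
  rwa [e] at key

/-- Two more lags in a window: `τ_{W+2} = τ_W + ρ(W+1) + ρ(W+2)`. -/
theorem tauIntWindow_add_two (ρ : ℕ → ℝ) (W : ℕ) :
    tauIntWindow ρ (W + 2) = tauIntWindow ρ W + ρ (W + 1) + ρ (W + 2) := by
  unfold tauIntWindow
  rw [Finset.sum_range_succ, Finset.sum_range_succ]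
  ring

/-- **Odd-ended windows are nondecreasing** for a reversible kernel: with `ρ(t) = C_g(t)/C_g(0)`,
`N ↦ τ_{2N+1} = 1/2 + Σ_{t=1}^{2N+1} ρ(t)` is monotone (each step adds a nonnegative pair). -/
theorem tauIntWindow_odd_mono_of_isReversible (hrev : Kernel.IsReversible κ π) {g : Ω → ℝ}
    (hg : Measurable g) {B : ℝ} (hB : ∀ x, |g x| ≤ B) :
    Monotone fun N : ℕ => tauIntWindow (fun t => autocov κ π g t / autocov κ π g 0) (2 * N + 1) := by
  refine monotone_nat_of_le_succ fun N => ?_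
  set ρ : ℕ → ℝ := fun t => autocov κ π g t / autocov κ π g 0 with hρ
  have hpair := autocov_pair_nonneg_of_isReversible hrev hg hB (N + 1)
  rw [show 2 * (N + 1) = 2 * N + 1 + 1 by ring] at hpair
  have h0 : 0 ≤ autocov κ π g 0 := by
    rw [autocov_zero]; exact integral_nonneg fun x => sq_nonneg _
  have hstep : 0 ≤ ρ (2 * N + 1 + 1) + ρ (2 * N + 1 + 2) := by
    simp only [hρ]
    rw [← add_div]
    exact div_nonneg hpair h0
  show tauIntWindow ρ (2 * N + 1) ≤ tauIntWindow ρ (2 * (N + 1) + 1)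
  rw [show 2 * (N + 1) + 1 = 2 * N + 1 + 2 by ring, tauIntWindow_add_two]
  linarith

/-- **Odd-ended windows never exceed `τ_int`** for a reversible kernel with a summable
autocorrelation: `τ_{2N+1} ≤ τ_int` for every `N` — an odd-ended Γ-window is a certified lower bound
for EVERY reversible sampler (negative odd lags are always paid for by the preceding even lag). -/
theorem tauIntWindow_odd_le_tauInt_of_isReversible (hrev : Kernel.IsReversible κ π) {g : Ω → ℝ}
    (hg : Measurable g) {B : ℝ} (hB : ∀ x, |g x| ≤ B)
    (hs : Summable fun t => autocov κ π g (t + 1) / autocov κ π g 0) (N : ℕ) :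
    tauIntWindow (fun t => autocov κ π g t / autocov κ π g 0) (2 * N + 1)
      ≤ tauInt (fun t => autocov κ π g t / autocov κ π g 0) := by
  set ρ : ℕ → ℝ := fun t => autocov κ π g t / autocov κ π g 0 with hρ
  -- the odd-ended windows converge to `τ_int` along `N ↦ 2N+1`
  have hlim : Tendsto (fun N : ℕ => tauIntWindow ρ (2 * N + 1)) atTop (𝓝 (tauInt ρ)) := by
    have h1 : Tendsto (fun W : ℕ => tauIntWindow ρ W) atTop (𝓝 (tauInt ρ)) := by
      unfold tauIntWindow tauInt
      exact tendsto_const_nhds.add hs.hasSum.tendsto_sum_nat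
    have h2 : Tendsto (fun N : ℕ => 2 * N + 1) atTop atTop :=
      tendsto_atTop_mono (fun N => by show N ≤ 2 * N + 1; omega) tendsto_id
    exact h1.comp h2
  exact (tauIntWindow_odd_mono_of_isReversible hrev hg hB).ge_of_tendsto hlim N

/-- **THE `τ_int` FLOOR FOR EVERY REVERSIBLE MARKOV KERNEL (Madras–Slade Prop. 9.2.2 on a general
state space).**  `κ` Markov and `π`-reversible, `π` a probability law; `g` bounded measurable with
`ρ(t) = autocov κ π g t / autocov κ π g 0`.  If `Σ_t ρ(t+1)` is summable and `ρ(1) < 1`, then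
`(1 + ρ(1))/(2(1 − ρ(1))) ≤ τ_int(g) = 1/2 + Σ_{t ≥ 1} ρ(t)`: the AR(1) value is the best case
compatible with a given lag-one autocorrelation.  (Row 2's abstract `reversible_tauInt_ge` with
`(μ, w, K) = (π, 1, kop κ)`; `Var_π g = 0` gives `ρ ≡ 0` and `1/2 ≤ 1/2`.) -/
theorem tauInt_ge_of_isReversible (hrev : Kernel.IsReversible κ π) {g : Ω → ℝ}
    (hg : Measurable g) {B : ℝ} (hB : ∀ x, |g x| ≤ B)
    (hs : Summable fun t => autocov κ π g (t + 1) / autocov κ π g 0)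
    (hρ : autocov κ π g 1 / autocov κ π g 0 < 1) :
    (1 + autocov κ π g 1 / autocov κ π g 0) / (2 * (1 - autocov κ π g 1 / autocov κ π g 0))
      ≤ tauInt (fun t => autocov κ π g t / autocov κ π g 0) := by
  have e0 : ∫ x, g x ^ 2 * (fun _ : Ω => (1 : ℝ)) x ∂π = autocov κ π g 0 := by
    simp only [mul_one]
    rw [autocov_zero]
  have e : ∀ n, (∫ x, g x * (kop κ)^[n] g x * (fun _ : Ω => (1 : ℝ)) x ∂π)
      / (∫ x, g x ^ 2 * (fun _ : Ω => (1 : ℝ)) x ∂π) = autocov κ π g n / autocov κ π g 0 := by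
    intro n
    rw [integral_mul_iterate_kop_mul_one, e0]
  have h1 : (∫ x, g x * kop κ g x * (fun _ : Ω => (1 : ℝ)) x ∂π)
      / (∫ x, g x ^ 2 * (fun _ : Ω => (1 : ℝ)) x ∂π) = autocov κ π g 1 / autocov κ π g 0 := by
    rw [← e 1]
    rfl
  have hs' : Summable fun n => (∫ x, g x * (kop κ)^[n + 1] g x * (fun _ : Ω => (1 : ℝ)) x ∂π)
      / ∫ x, g x ^ 2 * (fun _ : Ω => (1 : ℝ)) x ∂π := by
    refine hs.congr fun n => ?_
    exact (e (n + 1)).symm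
  have key := reversible_tauInt_ge (μ := π) (w := fun _ : Ω => (1 : ℝ)) (K := kop κ)
    (fun _ => one_pos) measurable_const (integrable_const _) kop_opBdd kop_opLin (kop_opSymm hrev)
    (kop_opContr hrev.invariant) hg hB hs' (by rw [h1]; exact hρ)
  rw [h1] at key
  have ef : (fun n => (∫ x, g x * (kop κ)^[n] g x * (fun _ : Ω => (1 : ℝ)) x ∂π)
      / ∫ x, g x ^ 2 * (fun _ : Ω => (1 : ℝ)) x ∂π) = fun t => autocov κ π g t / autocov κ π g 0 :=
    funext e
  rw [ef] at key
  exact key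

end Floor

end Summit.Ventures.LatticeQCDFlow.Scoring

end
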